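import Summits.FinalStateConjecture.FinalStateConjecture.Theses.ZeroEnergyKerrOrBomb
import Summits.FinalStateConjecture.FinalStateConjecture.Theorems.ZeroEnergyKerrOrBombKerrOrBombDock
import Summits.FinalStateConjecture.FinalStateConjecture.Theorems.ZeroEnergyKerrOrBombZeroEnergyRigidityRegularCase
import Summits.FinalStateConjecture.FinalStateConjecture.Theorems.ZeroEnergyKerrOrBombZeroEnergyRigidityStubDocIsometryTransfer
import Summits.FinalStateConjecture.FinalStateConjecture.Theorems.ZeroEnergyKerrOrBombZeroEnergyRigidityStubDocGloballyHyperbolicSet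
import Literature.Geometry.Manifold.OpenSubmanifoldMFDeriv

/-!
# Crux `KerrOrBomb` (stmt-FinalStateConjecture-10689) — kernel-checked CENSUS of the typed crux

Line lead c9 (prover-line-stmt-FinalStateConjecture-10689-c9-0), line `Dock`, 2026-08-16.

The registered skeleton of this crux (`Cruxes/KerrOrBomb/Lines/Dock.lean`, sha 70ee8bca) has ONE
open stub, `stub_zeroEnergyRigidity : ZeroEnergyRigidity` — the sibling crux
stmt-FinalStateConjecture-10690 BY NAME — through the landed dock
`KerrOrBombDock.kerrOrBomb_of_zeroEnergyRigidity` (p92061).  The sibling's registered skeleton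
(`Cruxes/ZeroEnergyRigidity/Lines/global_horizon_killing_field_c1.lean`, sha 963dbe15) in turn has
six open stubs: S1b `stub_futurePresentation` (WLOG future-presented; proved by its second lead, main
file not yet landed), S1c `stub_horizonCompletion` (the `I⁺`-regular re-presentation = horizon
completion; open in print) and the four Literature named facts `SudarskyWald1993_staticity`,
`ChruscielGalloway2010_docStaticUniqueness`, `BeigChrusciel1997_axisymmetricCombination`,
`ChruscielCostaHeusler2012_axisymmetricUniqueness` (Chruściel–Costa–Heusler, Living Rev. Relativ.
15 (2012) 7, §3: Thm. 3.1 via Sudarsky–Wald 1993 / Chruściel–Galloway 2010, Thm. 3.2 via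
Beig–Chruściel 1997).

This file turns that two-level dependency census into ONE kernel-checked theorem,
`kerrOrBomb_of_residues : S1b → S1c → SW93 → CG10 → BC97 → CCH12 → KerrOrBomb`, composed ONLY from
landed tree theorems (dock p92061, `RegularCase.stub_kerrConclusion_of_regular` p89982,
`DocIsometryTransfer.{exists_isIsometricImmersion_of_range_eq, stub_docIsometryTransfer}` p79890,
`DocGloballyHyperbolicSet.stub_docGloballyHyperbolicSet` p97727).  It is a CONDITIONAL result
(six hypotheses, no `sorry`): it certifies that, as typed, `KerrOrBomb` is implied by four deep
published theorems plus one future-presentation lemma plus one unpublished completion lemma, and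
that the mode-stability hypothesis (h6) of the typed crux is idle on that path (it is never used
below).  Registered as the additive stub `kerrOrBomb_of_residues` on stmt-FinalStateConjecture-10689.
-/

noncomputable section

-- `Summit.FinalStateConjecture.FinalStateConjecture.…`: summit = problem name (single-conjunct summit, D-0017).
set_option linter.dupNamespace false

namespace Summit.FinalStateConjecture.FinalStateConjecture.Theorems.KerrOrBomb.Census

open Set Function Literature.Geometry.Lorentzian
open scoped Manifold ContDiff Topology
open Summit.FinalStateConjecture.FinalStateConjecture.Theses.ZeroEnergyKerrOrBomb
  (KerrOrBomb ZeroEnergyRigidity)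
open Summit.FinalStateConjecture.FinalStateConjecture.Theorems.ZeroEnergyRigidity.GlobalHorizonKillingField

/-- The inclusion of the d.o.c. (open submanifold, restricted metric) of a presentation into the
carrier is a smooth isometric immersion (the differential of the inclusion of an open submanifold is
the identity).  O'Neill 1983, Ch. 3, pp. 57–58. -/
theorem isIsometricImmersion_doc_val (𝓑 : StationaryAFBlackHole.{0}) :
    PseudoRiemannianMetric.IsIsometricImmersion
      (𝓑.metric.restrict PseudoRiemannianMetric.contMDiff_restrict_holds
        (𝓑.docOpens LorentzianMetric.isOpen_chronologicalFuture_holds_of_boundaryless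
          LorentzianMetric.isOpen_chronologicalPast_holds_of_boundaryless)).toPseudoRiemannianMetric
      𝓑.metric.toPseudoRiemannianMetric Subtype.val := by
  refine ⟨contMDiff_subtype_val, fun x ↦ ?_⟩
  ext v w
  rw [pullbackBilin_apply, Literature.Geometry.Manifold.OpenSubmanifold.mfderiv_subtype_val]
  rfl

/-- **Census theorem of the typed crux `KerrOrBomb` (registered additive stub
`kerrOrBomb_of_residues`).**  The six residues of the sibling crux's registered skeleton imply the
typed crux BY NAME: S1b (WLOG future-presented) and S1c (horizon completion to an `I⁺`-regular
re-presentation with a complete `T`-commuting horizon Killing field) re-present the d.o.c.; the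
regular-case dichotomy (`RegularCase.stub_kerrConclusion_of_regular`, fed with the four named facts
Sudarsky–Wald 1993, Chruściel–Galloway 2010, Beig–Chruściel 1997, Chruściel–Costa–Heusler 2012)
gives the Kerr chart conclusion for the re-presentation; `DocIsometryTransfer` carries it back along
the composed d.o.c. isometry; the dock (`KerrOrBombDock.kerrOrBomb_of_zeroEnergyRigidity`) turns
`ZeroEnergyRigidity` into `KerrOrBomb`.  Hypotheses h5 (`T ≠ 0` on the d.o.c.), the zero-energy
non-trapping clause and h6 (mode stability) are never used.  Conditional result: no `sorry`, six
hypotheses.  Chruściel–Costa–Heusler 2012, §3; Chruściel–Costa 2008, Thm. 1.3 and Def. 1.1. -/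
theorem kerrOrBomb_of_residues :
    (∀ (𝓑 : Literature.Geometry.Lorentzian.StationaryAFBlackHole.{0}) [𝓑.metric.HasLeviCivita], 𝓑.metric.toPseudoRiemannianMetric.IsRicciFlat → IsConnected 𝓑.horizon → 𝓑.toSpacetime.IsNonDegenerateHorizon 𝓑.Mext → 𝓑.metric.IsGloballyHyperbolic 𝓑.timeOrientation → ∃ (𝓑' : Literature.Geometry.Lorentzian.StationaryAFBlackHole.{0}) (_ : 𝓑'.metric.HasLeviCivita), 𝓑'.metric.toPseudoRiemannianMetric.IsRicciFlat ∧ IsConnected 𝓑'.horizon ∧ 𝓑'.toSpacetime.IsNonDegenerateHorizon 𝓑'.Mext ∧ 𝓑'.metric.IsGloballyHyperbolic 𝓑'.timeOrientation ∧ (∀ p : 𝓑'.carrier, p ∈ 𝓑'.metric.chronologicalFuture 𝓑'.timeOrientation 𝓑'.Mext) ∧ ∃ ι : 𝓑'.carrier → 𝓑.carrier, Function.Injective ι ∧ Set.range ι = 𝓑.metric.chronologicalFuture 𝓑.timeOrientation 𝓑.Mext ∧ Literature.Geometry.Lorentzian.PseudoRiemannianMetric.IsIsometricImmersion 𝓑'.metric.toPseudoRiemannianMetric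 𝓑.metric.toPseudoRiemannianMetric ι ∧ (∀ x, mfderiv (𝓡 4) (𝓡 4) ι x (𝓑'.killing x) = 𝓑.killing (ι x)) ∧ ι '' 𝓑'.Mext ⊆ 𝓑.Mext ∧ ι '' 𝓑'.doc = 𝓑.doc ∧ ι '' 𝓑'.horizon = 𝓑.horizon) → (∀ (𝓑 : Literature.Geometry.Lorentzian.StationaryAFBlackHole.{0}) [𝓑.metric.HasLeviCivita], 𝓑.metric.toPseudoRiemannianMetric.IsRicciFlat → IsConnected 𝓑.horizon → 𝓑.toSpacetime.IsNonDegenerateHorizon 𝓑.Mext → 𝓑.metric.IsGloballyHyperbolic 𝓑.timeOrientation → 𝓑.toSpacetime.IsGloballyHyperbolicSet 𝓑.doc → (∀ p : 𝓑.carrier, p ∈ 𝓑.metric.chronologicalFuture 𝓑.timeOrientation 𝓑.Mext) → ∃ (𝓑' : Literature.Geometry.Lorentzian.StationaryAFBlackHole.{0}) (_ : 𝓑'.metric.HasLeviCivita), 𝓑'.metric.toPseudoRiemannianMetric.IsRicciFlat ∧ 𝓑'.IsIPlusRegular ∧ IsConnected 𝓑'.horizon ∧ (∃ K' : Π x : 𝓑'.carrier,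 TangentSpace (𝓡 4) x, 𝓑'.metric.IsKillingField K' ∧ Literature.Geometry.Lorentzian.IsCompleteVectorField K' ∧ (∀ x, VectorField.mlieBracket (𝓡 4) 𝓑'.killing K' x = 0) ∧ (∀ p ∈ 𝓑'.horizon, K' p ≠ 0) ∧ (∀ γ : ℝ → 𝓑'.carrier, IsMIntegralCurve γ K' → γ 0 ∈ 𝓑'.horizon → ∀ t, γ t ∈ 𝓑'.horizon) ∧ ∃ κ : ℝ, κ ≠ 0 ∧ ∀ p ∈ 𝓑'.horizon, 𝓑'.metric.leviCivita K' p (K' p) = κ • K' p) ∧ ∃ Θ : ↥(𝓑'.docOpens Literature.Geometry.Lorentzian.LorentzianMetric.isOpen_chronologicalFuture_holds_of_boundaryless Literature.Geometry.Lorentzian.LorentzianMetric.isOpen_chronologicalPast_holds_of_boundaryless) → 𝓑.carrier, Function.Injective Θ ∧ Set.range Θ = 𝓑.doc ∧ Literature.Geometry.Lorentzian.PseudoRiemannianMetric.IsIsometricImmersion (𝓑'.metric.restrict Literature.Geometry.Lorentzian.PseudoRiemannianMetric.contMDiff_restrict_holds (𝓑'.docOpens Literature.Geometry.Lorentzian.LorentzianMetric.isOpen_chronologicalFuture_holds_of_boundaryless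 Literature.Geometry.Lorentzian.LorentzianMetric.isOpen_chronologicalPast_holds_of_boundaryless)).toPseudoRiemannianMetric 𝓑.metric.toPseudoRiemannianMetric Θ) → Literature.Geometry.Lorentzian.SudarskyWald1993_staticity → Literature.Geometry.Lorentzian.ChruscielGalloway2010_docStaticUniqueness → Literature.Geometry.Lorentzian.BeigChrusciel1997_axisymmetricCombination.{0} → Literature.Geometry.Lorentzian.ChruscielCostaHeusler2012_axisymmetricUniqueness.{0} → Summit.FinalStateConjecture.FinalStateConjecture.Theses.ZeroEnergyKerrOrBomb.KerrOrBomb := by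
  intro hS1b hS1c hSW hCG hBC hCCH
  refine KerrOrBombDock.kerrOrBomb_of_zeroEnergyRigidity ?_
  intro 𝓑 _ _ h1 h2 h3 h4 _h5 _h6
  -- Step 1 (S1b): WLOG future-presented, with a `T`-equivariant d.o.c.-preserving isometry `ι`.
  obtain ⟨𝓑₁, inst₁, h1₁, h2₁, h3₁, h4₁, hfp₁, ι, hιinj, -, hιiso, -, -, hιdoc, -⟩ :=
    hS1b 𝓑 h1 h2 h3 h4
  haveI := inst₁
  -- Step 2 (S1a, landed + S1c): the d.o.c. of `𝓑₁` is a globally hyperbolic set; complete the horizon.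
  obtain ⟨𝓑', inst', h1', hreg', hconn', hK', Θ₁, hΘ₁inj, hΘ₁range, hΘ₁iso⟩ :=
    hS1c 𝓑₁ h1₁ h2₁ h3₁ h4₁ (DocGloballyHyperbolicSet.stub_docGloballyHyperbolicSet 𝓑₁ h4₁) hfp₁
  haveI := inst'
  -- Step 3: the d.o.c. isometry of `𝓑₁` into `𝓑` is the inclusion of `⟨⟨M_ext₁⟩⟩` followed by `ι`;
  -- compose it with `Θ₁` (corestricted) to get `Θ : ⟨⟨M_ext'⟩⟩ → 𝓑` onto `𝓑.doc`.
  set U₁ := 𝓑₁.docOpens LorentzianMetric.isOpen_chronologicalFuture_holds_of_boundaryless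
    LorentzianMetric.isOpen_chronologicalPast_holds_of_boundaryless with hU₁
  have hΘ₂inj : Function.Injective (ι ∘ (Subtype.val : U₁ → 𝓑₁.carrier)) :=
    hιinj.comp Subtype.val_injective
  have hΘ₂iso : PseudoRiemannianMetric.IsIsometricImmersion
      (𝓑₁.metric.restrict PseudoRiemannianMetric.contMDiff_restrict_holds U₁).toPseudoRiemannianMetric
      𝓑.metric.toPseudoRiemannianMetric (ι ∘ (Subtype.val : U₁ → 𝓑₁.carrier)) :=
    hιiso.comp (isIsometricImmersion_doc_val 𝓑₁)
  have hΘ₂range : Set.range (ι ∘ (Subtype.val : U₁ → 𝓑₁.carrier)) = 𝓑.doc := by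
    rw [Set.range_comp, Subtype.range_coe_subtype, ← hιdoc]
    rfl
  obtain ⟨Θ, hΘinj, hΘrange, hΘiso⟩ :=
    DocIsometryTransfer.exists_isIsometricImmersion_of_range_eq
      PseudoRiemannianMetric.contMDiff_restrict_holds U₁ hΘ₂inj hΘ₂iso hΘ₁inj hΘ₁range hΘ₁iso
  -- Step 4: the regular case (four named facts) for `𝓑'`, transported back to `𝓑` along `Θ`.
  exact DocIsometryTransfer.stub_docIsometryTransfer 𝓑 𝓑' ⟨Θ, hΘinj, hΘrange.trans hΘ₂range, hΘiso⟩
    (RegularCase.stub_kerrConclusion_of_regular hSW hCG hCCH hBC 𝓑' h1' hreg' hconn' hK')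

end Summit.FinalStateConjecture.FinalStateConjecture.Theorems.KerrOrBomb.Census

end
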